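import Summits.MatrixMultiplication.MatrixMultiplication.Theorems.OutsiderSandwichCoherentSharing
import Mathlib.RingTheory.SimpleRing.Matrix
import HarnessLib

/-!
# Zero output slack forces `2^N` copies: output cancellation is necessary for any rate below `1`

Route `OutsiderSandwich` (decomposition cell `decomp-mm`, lens 4 «minimal counterexample /
extremal reduction», gen 28, kernel 3), support for the aside leaf `BlockOneIsMM`
(stmt-MatrixMultiplication-27147, `θ⋆ = 0`); cut of record untouched; theorem-only.

## Content

In the wiring normal form of a certificate (`OutsiderSandwichCoherentSharing`),
`Σ_{(i,c) ∈ T} R_{i,c}(τ_c(A_i X) · L_{i,c} Y) = X · Y` on `2^N × 2^N` matrices, the `|T|` wired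
blocks emit `|T| · 2^N` output coordinates which the maps `R_{i,c}` recombine into the `4^N`
entries of `X · Y`; so `|T| ≥ 2^N`, and `|T| - 2^N` is the OUTPUT SLACK (the amount of
cancellation between block outputs).  The extremal case is rigid:

* `card_eq_of_noSlack` — if `|T| ≤ 2^N` then `|T| = 2^N` and the output map
  `w ↦ Σ_b R_b(w_b)` is a linear BIJECTION `(K^{2^N})^T ≅ M_{2^N}(K)`.
* `block_transport`, `block_section` — hence every wired block satisfies, on its own,
  `τ_c(A_i X) · L Y = G · L(X Y)` with `G = τ_c(A_i 1)` invertible and `L = L_{i,c}` onto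
  (`isUnit_gauge`, `leg_surjective`);
* `block_mul`, `block_surjective` — so `X ↦ τ_c(A_i X) · G⁻¹` is a unital ring endomorphism of
  the simple algebra `M_{2^N}(K)`, injective, hence bijective;
* `wires_injective` — and a copy CANNOT wire two different blocks: transporting the
  multiplicativity from block `c` to block `c'` of the same copy makes `τ_{c+c'}` multiplicative,
  contradicting `OutsiderSandwichTwistGluing.ptrans_not_multiplicative`;
* `two_pow_le_card_of_noSlack` — therefore `|ι| ≥ |T| = 2^N`: **a certificate without output
  slack has rate `1`**; equivalently (`card_lt_of_card_lt`) every certificate with fewer than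
  `2^N` copies — every point of the exchange curve below the trivial one, in particular the core
  `⌈(4/3)^N⌉` and anything approaching `θ⋆ = 0` — has `|T| > 2^N`: its blocks' outputs CANCEL.

With `OutsiderSandwichCoherentSharing` / `OutsiderSandwichCoherentProfile` this brackets the
mechanism of cheap certificates from both sides: INPUT side, rate `< 0.2933` needs incoherent
(relatively sign-twisted) sharing of `x`-legs; OUTPUT side, rate `< 1` needs output cancellation.
The minimal sub-core certificate the census hunts (`(N, B) = (3, 2)`: `|T| ≥ 9 > 8`) must do both.

## References

* N. Jacobson, *Basic Algebra II*, 2nd ed. (1989), §4.6 (simplicity of matrix rings; the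
  Skolem–Noether circle of ideas). [Jacobson1989]
* M. Bläser, *Fast Matrix Multiplication*, Theory of Computing Graduate Surveys 5 (2013), §5
  (restrictions of `⟨2,2,2⟩^{⊗N}`, substitution method). [Blaser2013]
-/

noncomputable section

open scoped BigOperators Matrix

set_option linter.dupNamespace false
set_option autoImplicit false

namespace Summit.MatrixMultiplication.MatrixMultiplication.Theorems.OutsiderSandwichZeroSlack

open Summit.MatrixMultiplication.MatrixMultiplication.Theorems.OutsiderSandwichTwistGluing
  Summit.MatrixMultiplication.MatrixMultiplication.Theorems.OutsiderSandwichTwistCapacity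
  Summit.MatrixMultiplication.MatrixMultiplication.Theorems.OutsiderSandwichColumnDisjoint

universe u v

variable {N : ℕ} {K : Type u} [Field K] {ι : Type v}

/-! ## 1. The output map and the no-slack dimension count -/

/-- The **output map** of a wiring: block outputs `w_b ∈ K^{2^N}`, `b ∈ T`, are recombined into
`Σ_b R_b(w_b)`. -/
def outMap (T : Finset (ι × Idx N)) (R : ι → Idx N → ((Idx N → K) →ₗ[K] Matrix (Idx N) (Idx N) K)) :
    (↥T → (Idx N → K)) →ₗ[K] Matrix (Idx N) (Idx N) K where
  toFun w := ∑ b : ↥T, R b.1.1 b.1.2 (w b)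
  map_add' w w' := by simp only [Pi.add_apply, map_add, Finset.sum_add_distrib]
  map_smul' a w := by simp only [Pi.smul_apply, map_smul, RingHom.id_apply, Finset.smul_sum]

/-- Unfolding the output map. -/
theorem outMap_apply (T : Finset (ι × Idx N))
    (R : ι → Idx N → ((Idx N → K) →ₗ[K] Matrix (Idx N) (Idx N) K)) (w : ↥T → (Idx N → K)) :
    outMap T R w = ∑ b : ↥T, R b.1.1 b.1.2 (w b) := rfl

section Wiring

variable (A : ι → Matrix (Idx N) (Idx N) K →ₗ[K] Matrix (Idx N) (Idx N) K) (T : Finset (ι × Idx N))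
  (L : ι → Idx N → (Matrix (Idx N) (Idx N) K →ₗ[K] (Idx N → K)))
  (R : ι → Idx N → ((Idx N → K) →ₗ[K] Matrix (Idx N) (Idx N) K))

/-- The wiring identity says: the output map sends the block outputs on `(X, Y)` to `X · Y`. -/
theorem outMap_wired
    (ident : ∀ X Y : Matrix (Idx N) (Idx N) K,
      ∑ b ∈ T, R b.1 b.2 (Matrix.mulVec (ptrans b.2 (A b.1 X)) (L b.1 b.2 Y)) = X * Y)
    (X Y : Matrix (Idx N) (Idx N) K) :
    outMap T R (fun b => Matrix.mulVec (ptrans b.1.2 (A b.1.1 X)) (L b.1.1 b.1.2 Y)) = X * Y := by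
  rw [outMap_apply, ← ident X Y]
  exact Finset.sum_coe_sort T
    (fun b => R b.1 b.2 (Matrix.mulVec (ptrans b.2 (A b.1 X)) (L b.1 b.2 Y)))

/-- The output map is onto (`Z = Z · 1`). -/
theorem outMap_surjective
    (ident : ∀ X Y : Matrix (Idx N) (Idx N) K,
      ∑ b ∈ T, R b.1 b.2 (Matrix.mulVec (ptrans b.2 (A b.1 X)) (L b.1 b.2 Y)) = X * Y) :
    Function.Surjective (outMap T R) := fun Z =>
  ⟨fun b => Matrix.mulVec (ptrans b.1.2 (A b.1.1 Z)) (L b.1.1 b.1.2 1),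
    by rw [outMap_wired A T L R ident, Matrix.mul_one]⟩

/-- `dim (K^{2^N})^T = |T| · 2^N`. -/
theorem finrank_wires : Module.finrank K (↥T → (Idx N → K)) = T.card * 2 ^ N := by
  rw [Module.finrank_pi_fintype, Finset.sum_const, Finset.card_univ, Fintype.card_coe, smul_eq_mul,
    Module.finrank_fintype_fun_eq_card, card_Idx]

/-- **No slack is rigid, I.**  If `|T| ≤ 2^N` then `|T| = 2^N` and the output map is injective
(hence a linear bijection `(K^{2^N})^T ≅ M_{2^N}(K)`). -/
theorem card_eq_of_noSlack
    (ident : ∀ X Y : Matrix (Idx N) (Idx N) K,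
      ∑ b ∈ T, R b.1 b.2 (Matrix.mulVec (ptrans b.2 (A b.1 X)) (L b.1 b.2 Y)) = X * Y)
    (hT : T.card ≤ 2 ^ N) : T.card = 2 ^ N ∧ Function.Injective (outMap T R) := by
  have hsurj := outMap_surjective A T L R ident
  have hrk := LinearMap.finrank_range_add_finrank_ker (outMap T R)
  rw [LinearMap.range_eq_top.2 hsurj, finrank_top, finrank_matrix_Idx, finrank_wires] at hrk
  have h4 : (4 : ℕ) ^ N = 2 ^ N * 2 ^ N := by rw [← mul_pow]; norm_num
  have h1 : 4 ^ N ≤ T.card * 2 ^ N := hrk ▸ Nat.le_add_right _ _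
  have h2 : T.card * 2 ^ N ≤ 4 ^ N := h4 ▸ Nat.mul_le_mul_right _ hT
  have heq : T.card * 2 ^ N = 4 ^ N := le_antisymm h2 h1
  refine ⟨Nat.eq_of_mul_eq_mul_right (pow_pos two_pos N) (heq.trans h4), ?_⟩
  exact (LinearMap.injective_iff_surjective_of_finrank_eq_finrank
    (by rw [finrank_wires, finrank_matrix_Idx, heq])).2 hsurj

/-! ## 2. Block rigidity under no slack -/

/-- **Transport identity of a wired block**: `τ_c(A_i X) · L Y = G · L(X · Y)`, `G = τ_c(A_i 1)`
(compare the block outputs of `(X, Y)` and `(1, X Y)`, which the injective output map separates). -/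
theorem block_transport
    (ident : ∀ X Y : Matrix (Idx N) (Idx N) K,
      ∑ b ∈ T, R b.1 b.2 (Matrix.mulVec (ptrans b.2 (A b.1 X)) (L b.1 b.2 Y)) = X * Y)
    (hT : T.card ≤ 2 ^ N) {i : ι} {c : Idx N} (hb : (i, c) ∈ T) (X Y : Matrix (Idx N) (Idx N) K) :
    Matrix.mulVec (ptrans c (A i X)) (L i c Y) =
      Matrix.mulVec (ptrans c (A i 1)) (L i c (X * Y)) := by
  have hinj := (card_eq_of_noSlack A T L R ident hT).2
  have h := hinj ((outMap_wired A T L R ident X Y).trans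
    ((outMap_wired A T L R ident 1 (X * Y)).trans (Matrix.one_mul _)).symm)
  exact congrFun h ⟨(i, c), hb⟩

/-- **Section identity of a wired block**: `τ_c(A_i (R_{i,c} v)) · L 1 = v` (the block output
`v` placed at `b = (i, c)` alone is the output pattern of `(R_{i,c} v, 1)`). -/
theorem block_section [DecidableEq ι]
    (ident : ∀ X Y : Matrix (Idx N) (Idx N) K,
      ∑ b ∈ T, R b.1 b.2 (Matrix.mulVec (ptrans b.2 (A b.1 X)) (L b.1 b.2 Y)) = X * Y)
    (hT : T.card ≤ 2 ^ N) {i : ι} {c : Idx N} (hb : (i, c) ∈ T) (v : Idx N → K) :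
    Matrix.mulVec (ptrans c (A i (R i c v))) (L i c 1) = v := by
  classical
  have hinj := (card_eq_of_noSlack A T L R ident hT).2
  have hw : outMap T R (Pi.single (⟨(i, c), hb⟩ : ↥T) v) = R i c v := by
    rw [outMap_apply, Finset.sum_eq_single (⟨(i, c), hb⟩ : ↥T)]
    · rw [Pi.single_eq_same]
    · intro b _ hne; rw [Pi.single_eq_of_ne hne, map_zero]
    · intro h; exact absurd (Finset.mem_univ _) h
  have h := hinj (hw.trans ((outMap_wired A T L R ident (R i c v) 1).trans (Matrix.mul_one _)).symm)
  have h' := congrFun h ⟨(i, c), hb⟩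
  rw [Pi.single_eq_same] at h'
  exact h'.symm

/-- The **gauge** `G = τ_c(A_i 1)` of a wired block is invertible. -/
theorem isUnit_gauge [DecidableEq ι]
    (ident : ∀ X Y : Matrix (Idx N) (Idx N) K,
      ∑ b ∈ T, R b.1 b.2 (Matrix.mulVec (ptrans b.2 (A b.1 X)) (L b.1 b.2 Y)) = X * Y)
    (hT : T.card ≤ 2 ^ N) {i : ι} {c : Idx N} (hb : (i, c) ∈ T) : IsUnit (ptrans c (A i 1)) := by
  rw [← Matrix.mulVec_surjective_iff_isUnit]
  intro v
  refine ⟨L i c (R i c v * 1), ?_⟩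
  rw [← block_transport A T L R ident hT hb, block_section A T L R ident hT hb]

/-- The `y`-leg `L_{i,c}` of a wired block is onto `K^{2^N}`. -/
theorem leg_surjective [DecidableEq ι]
    (ident : ∀ X Y : Matrix (Idx N) (Idx N) K,
      ∑ b ∈ T, R b.1 b.2 (Matrix.mulVec (ptrans b.2 (A b.1 X)) (L b.1 b.2 Y)) = X * Y)
    (hT : T.card ≤ 2 ^ N) {i : ι} {c : Idx N} (hb : (i, c) ∈ T) :
    Function.Surjective (L i c) := by
  intro u
  refine ⟨R i c (Matrix.mulVec (ptrans c (A i 1)) u) * 1, ?_⟩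
  apply Matrix.mulVec_injective_iff_isUnit.2 (isUnit_gauge A T L R ident hT hb)
  show Matrix.mulVec (ptrans c (A i 1)) _ = Matrix.mulVec (ptrans c (A i 1)) u
  rw [← block_transport A T L R ident hT hb, block_section A T L R ident hT hb]

/-- **Multiplicative normal form of a wired block**: `τ_c(A_i (X Z)) = τ_c(A_i X) · G⁻¹ · τ_c(A_i Z)`,
i.e. `X ↦ τ_c(A_i X) · G⁻¹` is a unital ring endomorphism of `M_{2^N}(K)`. -/
theorem block_mul [DecidableEq ι]
    (ident : ∀ X Y : Matrix (Idx N) (Idx N) K,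
      ∑ b ∈ T, R b.1 b.2 (Matrix.mulVec (ptrans b.2 (A b.1 X)) (L b.1 b.2 Y)) = X * Y)
    (hT : T.card ≤ 2 ^ N) {i : ι} {c : Idx N} (hb : (i, c) ∈ T) (X Z : Matrix (Idx N) (Idx N) K) :
    ptrans c (A i (X * Z)) = ptrans c (A i X) * (ptrans c (A i 1))⁻¹ * ptrans c (A i Z) := by
  have hG : IsUnit (ptrans c (A i 1)).det :=
    (Matrix.isUnit_iff_isUnit_det _).1 (isUnit_gauge A T L R ident hT hb)
  apply Matrix.toLin'.injective
  apply LinearMap.ext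
  intro u
  rw [Matrix.toLin'_apply, Matrix.toLin'_apply]
  obtain ⟨Y, rfl⟩ := leg_surjective A T L R ident hT hb u
  rw [block_transport A T L R ident hT hb (X * Z) Y, Matrix.mul_assoc X Z Y,
    ← block_transport A T L R ident hT hb X (Z * Y), ← Matrix.mulVec_mulVec, ← Matrix.mulVec_mulVec]
  congr 1
  rw [block_transport A T L R ident hT hb Z Y, Matrix.mulVec_mulVec, Matrix.nonsing_inv_mul _ hG,
    Matrix.one_mulVec]

/-- **The `x`-leg of a wired block is onto**: `X ↦ τ_c(A_i X)` is surjective on `M_{2^N}(K)`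
(a unital ring endomorphism of a simple algebra is injective, and it is `K`-linear). -/
theorem block_surjective [DecidableEq ι]
    (ident : ∀ X Y : Matrix (Idx N) (Idx N) K,
      ∑ b ∈ T, R b.1 b.2 (Matrix.mulVec (ptrans b.2 (A b.1 X)) (L b.1 b.2 Y)) = X * Y)
    (hT : T.card ≤ 2 ^ N) {i : ι} {c : Idx N} (hb : (i, c) ∈ T) (W : Matrix (Idx N) (Idx N) K) :
    ∃ X, ptrans c (A i X) = W := by
  have hG : IsUnit (ptrans c (A i 1)).det :=
    (Matrix.isUnit_iff_isUnit_det _).1 (isUnit_gauge A T L R ident hT hb)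
  have hmul := block_mul A T L R ident hT hb
  let φ : Matrix (Idx N) (Idx N) K →ₗ[K] Matrix (Idx N) (Idx N) K :=
    { toFun := fun X => ptrans c (A i X) * (ptrans c (A i 1))⁻¹
      map_add' := fun X X' => by simp only [map_add, ptrans_add, Matrix.add_mul]
      map_smul' := fun a X => by simp only [map_smul, ptrans_smul, Matrix.smul_mul, RingHom.id_apply] }
  let φr : Matrix (Idx N) (Idx N) K →+* Matrix (Idx N) (Idx N) K :=
    { toFun := fun X => ptrans c (A i X) * (ptrans c (A i 1))⁻¹
      map_one' := Matrix.mul_nonsing_inv _ hG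
      map_mul' := fun X Z => by
        show ptrans c (A i (X * Z)) * (ptrans c (A i 1))⁻¹ =
          ptrans c (A i X) * (ptrans c (A i 1))⁻¹ * (ptrans c (A i Z) * (ptrans c (A i 1))⁻¹)
        rw [hmul X Z, Matrix.mul_assoc]
      map_zero' := by
        show ptrans c (A i 0) * (ptrans c (A i 1))⁻¹ = 0
        rw [map_zero, ptrans_zero_matrix, Matrix.zero_mul]
      map_add' := fun X X' => by
        show ptrans c (A i (X + X')) * (ptrans c (A i 1))⁻¹ = _
        rw [map_add, ptrans_add, Matrix.add_mul] }
  have hinj : Function.Injective φ := RingHom.injective φr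
  obtain ⟨X, hX⟩ := (LinearMap.injective_iff_surjective.1 hinj) (W * (ptrans c (A i 1))⁻¹)
  refine ⟨X, ?_⟩
  have h := congrArg (fun V => V * ptrans c (A i 1)) hX
  simp only [φ, LinearMap.coe_mk, AddHom.coe_mk] at h
  rwa [Matrix.nonsing_inv_mul_cancel_right (ptrans c (A i 1)) _ hG,
    Matrix.nonsing_inv_mul_cancel_right (ptrans c (A i 1)) _ hG] at h

/-! ## 3. A copy cannot wire two blocks without slack -/

/-- `(ℤ/2)^N` has exponent two. -/
private theorem add_self_eq_zero (a : Idx N) : a + a = 0 :=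
  funext fun k => by
    have h : ∀ x : Fin 2, x + x = 0 := by decide
    exact h (a k)

/-- **No slack is rigid, II.**  Without output slack a copy wires at most one block: two wired
blocks `(i, c), (i, c')` of the same copy with `c ≠ c'` would make `τ_{c+c'}` multiplicative on
`M_{2^N}(K)`, contradicting `OutsiderSandwichTwistGluing.ptrans_not_multiplicative`. -/
theorem wires_injective [DecidableEq ι]
    (ident : ∀ X Y : Matrix (Idx N) (Idx N) K,
      ∑ b ∈ T, R b.1 b.2 (Matrix.mulVec (ptrans b.2 (A b.1 X)) (L b.1 b.2 Y)) = X * Y)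
    (hT : T.card ≤ 2 ^ N) {i : ι} {c c' : Idx N} (hb : (i, c) ∈ T) (hb' : (i, c') ∈ T) :
    c = c' := by
  by_contra hne
  have hc' : c + (c + c') = c' := by rw [← add_assoc, add_self_eq_zero, zero_add]
  have hd : c + c' ≠ 0 := fun h => hne (by rw [← hc', h, add_zero])
  have hG : IsUnit (ptrans c (A i 1)).det :=
    (Matrix.isUnit_iff_isUnit_det _).1 (isUnit_gauge A T L R ident hT hb)
  have hsurj := block_surjective A T L R ident hT hb
  have hmul := block_mul A T L R ident hT hb
  have hmul' := block_mul A T L R ident hT hb'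
  have hM' : ∀ X, ptrans c' (A i X) = ptrans (c + c') (ptrans c (A i X)) := fun X => by
    rw [ptrans_comp, hc']
  -- transport the multiplicative normal form of block `c` to block `c'`
  have h6 : ∀ U W : Matrix (Idx N) (Idx N) K, ptrans (c + c') (U * W) =
      ptrans (c + c') (U * ptrans c (A i 1)) * (ptrans c' (A i 1))⁻¹ * ptrans (c + c') W := by
    intro U W
    obtain ⟨X, hX⟩ := hsurj (U * ptrans c (A i 1))
    obtain ⟨Z, hZ⟩ := hsurj W
    have h := hmul' X Z
    rw [hM' (X * Z), hM' X, hM' Z, hmul X Z, hX, hZ,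
      Matrix.mul_nonsing_inv_cancel_right (ptrans c (A i 1)) U hG] at h
    exact h
  have h7 : ∀ U : Matrix (Idx N) (Idx N) K,
      ptrans (c + c') (U * ptrans c (A i 1)) * (ptrans c' (A i 1))⁻¹ = ptrans (c + c') U := by
    intro U
    have h := h6 U 1
    rw [Matrix.mul_one, ptrans_one, Matrix.mul_one] at h
    exact h.symm
  refine ptrans_not_multiplicative (R := K) hd fun U W => ?_
  rw [h6 U W, h7 U]

/-! ## 4. Zero slack forces `2^N` copies -/

/-- **Zero output slack forces `2^N` copies** (`|T| ≤ 2^N ⟹ |ι| ≥ 2^N`): a certificate whose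
block outputs do not cancel has exchange rate `1`, the rate of the trivial algorithm. -/
theorem two_pow_le_card_of_noSlack [Fintype ι] [DecidableEq ι]
    (ident : ∀ X Y : Matrix (Idx N) (Idx N) K,
      ∑ b ∈ T, R b.1 b.2 (Matrix.mulVec (ptrans b.2 (A b.1 X)) (L b.1 b.2 Y)) = X * Y)
    (hT : T.card ≤ 2 ^ N) : 2 ^ N ≤ Fintype.card ι := by
  classical
  rw [← (card_eq_of_noSlack A T L R ident hT).1]
  have h := Finset.card_le_card_of_injOn (fun b : ι × Idx N => b.1)
    (fun b _ => Finset.mem_coe.2 (Finset.mem_univ b.1))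
    (fun b hb b' hb' h => by
      have hbT : (b.1, b.2) ∈ T := by rw [Prod.mk.eta]; exact hb
      have hb'T : (b.1, b'.2) ∈ T := by rw [show b.1 = b'.1 from h, Prod.mk.eta]; exact hb'
      exact Prod.ext h (wires_injective A T L R ident hT hbT hb'T))
  rwa [Finset.card_univ] at h

/-- **Output cancellation is necessary for any rate below `1`**: a certificate with fewer than
`2^N` copies wires more than `2^N` blocks, so the `R`-recombination of their outputs cancels. -/
theorem card_lt_of_card_lt [Fintype ι] [DecidableEq ι]
    (ident : ∀ X Y : Matrix (Idx N) (Idx N) K,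
      ∑ b ∈ T, R b.1 b.2 (Matrix.mulVec (ptrans b.2 (A b.1 X)) (L b.1 b.2 Y)) = X * Y)
    (hι : Fintype.card ι < 2 ^ N) : 2 ^ N < T.card :=
  not_le.1 fun hT => absurd (two_pow_le_card_of_noSlack A T L R ident hT) (not_le.2 hι)

/-- In particular the minimal sub-core certificate sought by the census (`N = 3`, two copies)
wires at least `9 > 8 = 2^3` blocks across its two copies. -/
theorem subcore_three_two_slack [Fintype ι] [DecidableEq ι]
    (A : ι → Matrix (Idx 3) (Idx 3) K →ₗ[K] Matrix (Idx 3) (Idx 3) K) (T : Finset (ι × Idx 3))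
    (L : ι → Idx 3 → (Matrix (Idx 3) (Idx 3) K →ₗ[K] (Idx 3 → K)))
    (R : ι → Idx 3 → ((Idx 3 → K) →ₗ[K] Matrix (Idx 3) (Idx 3) K))
    (ident : ∀ X Y : Matrix (Idx 3) (Idx 3) K,
      ∑ b ∈ T, R b.1 b.2 (Matrix.mulVec (ptrans b.2 (A b.1 X)) (L b.1 b.2 Y)) = X * Y)
    (hι : Fintype.card ι = 2) : 9 ≤ T.card := by
  have h := card_lt_of_card_lt A T L R ident (by rw [hι]; norm_num)
  norm_num at h
  omega

end Wiring

end Summit.MatrixMultiplication.MatrixMultiplication.Theorems.OutsiderSandwichZeroSlack
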